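import Summits.NavierStokesRegularity.NavierStokesRegularity.Theorems.EfficiencyFloorProductionEfficiencyDecayTypeIRecurrenceDensity
import Summits.NavierStokesRegularity.NavierStokesRegularity.Theorems.EfficiencyFloorProductionEfficiencyDecayReduction
import HarnessLib

/-!
# The sandwich `ProductionEfficiencyDecay ⇒ VanishingGrowthDensity ⇒ floor` (line `efficiency_floor`,
# crux `EfficiencyFloor.ProductionEfficiencyDecay`, stmt-NavierStokesRegularity-22866; `--supports`)

`Theorems/EfficiencyFloorProductionEfficiencyDecayTypeIRecurrenceDensity.lean` proved that VANISHING GROWTH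
DENSITY along a maximal solution (for every `W, κ > 0`, eventually the cubic-growth instants
`Z³/(4W²) ≤ Ż` in `(t,T)` have measure `≤ κ(T−t)`) already gives the super-Leray floor that the route's
deciding theorem consumes (`floor_of_vanishingGrowthDensity`), and typed the deciding theorem
`navierStokesRegularity_of_vanishingGrowthDensity_of_quarterLaw`. This file kernel-checks the other side
of the sandwich: the crux `ProductionEfficiencyDecay` (equivalently its registered crux-proper stub S2,
`…Reduction.lean`) EMPTIES the growth sets near `T`, hence implies vanishing growth density
(`vanishingGrowthDensity_of_productionEfficiencyDecay`). So, along every maximal smooth Leray–Hopf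
rapidly-decaying-datum solution,

  `ProductionEfficiencyDecay ⇒ VanishingGrowthDensity ⇒ (∀ K, eventually K/√(T−t) < Z(t))`,

and the middle statement is a weaker sufficient crux for the route `EfficiencyFloor` (same residual
`EnstrophyQuarterLaw`). It remains open-problem grade: any Leray-rate blow-up refutes it
(`…Negative/ProductionEfficiencyDecayFalseOfLerayRateBlowup.lean` applies verbatim to the floor).

HONEST FRAMING: implications between statements about HYPOTHETICAL blow-ups; the crux is NOT proved; NS
regularity is NOT proved by anything here; no summit is claimed. [folklore]
-/

-- the problem directory repeats the summit name (`NavierStokesRegularity/NavierStokesRegularity`)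
set_option linter.dupNamespace false

noncomputable section

open Set Filter MeasureTheory Topology
open scoped InnerProductSpace ENNReal NNReal
open Literature.Analysis.FluidPDE

namespace Summit.NavierStokesRegularity.NavierStokesRegularity.Theorems

namespace TypeIRecurrence

variable {ν T : ℝ} {u : ℝ → EuclideanSpace ℝ (Fin 3) → EuclideanSpace ℝ (Fin 3)}
  {p : ℝ → EuclideanSpace ℝ (Fin 3) → ℝ}

/-- **The crux empties the growth sets.** Under `ProductionEfficiencyDecay`, along every maximal smooth
Leray–Hopf rapidly-decaying-datum solution and for every `W > 0`: eventually (in `t ↑ T`) NO instant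
`s ∈ (t,T)` has cubic growth `Z(s)³/(4W²) ≤ Ż(s)` (intrinsic real enstrophy `Z = (∫⁻|curl u|²).toReal`,
`Ż = deriv Z`). [folklore] -/
theorem growthSet_eq_empty_of_productionEfficiencyDecay
    (hE : Summit.NavierStokesRegularity.NavierStokesRegularity.Theses.EfficiencyFloor.ProductionEfficiencyDecay)
    (hν : 0 < ν) (hT : 0 < T) (hmax : IsMaximalSmoothSolution ν 0 u p T)
    (hLH : IsLerayHopfOn T ν 0 (u 0) u) (hdec : HasRapidSpatialDecay (u 0)) {W : ℝ} (hW : 0 < W) :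
    ∀ᶠ t in 𝓝[<] T,
      {s | s ∈ Ioo t T ∧
        (∫⁻ x, ‖curl (u s) x‖ₑ ^ 2).toReal ^ 3 / (4 * W ^ 2) ≤
          deriv (fun r => (∫⁻ x, ‖curl (u r) x‖ₑ ^ 2).toReal) s} = ∅ := by
  obtain ⟨c, hc, hB⟩ := EnstrophyBudget.main
  obtain ⟨Zr, Pr, Sr, hZ⟩ := hB ν T hν hT u p hmax hLH hdec
  -- the intrinsic enstrophy agrees with `Zr` on `(0,T)`, with derivative `2S − 2ν·Pal`
  have hZfun : ∀ s ∈ Ioo 0 T, (∫⁻ x, ‖curl (u s) x‖ₑ ^ 2).toReal = Zr s := fun s hs => by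
    rw [(hZ s hs).1, ENNReal.toReal_ofReal (hZ s hs).2.1]
  have hderiv : ∀ s ∈ Ioo 0 T,
      deriv (fun r => (∫⁻ x, ‖curl (u r) x‖ₑ ^ 2).toReal) s = 2 * Sr s - 2 * ν * Pr s := by
    intro s hs
    have heq : (fun r => (∫⁻ x, ‖curl (u r) x‖ₑ ^ 2).toReal) =ᶠ[𝓝 s] Zr :=
      Filter.eventuallyEq_of_mem (Ioo_mem_nhds hs.1 hs.2) fun r hr => hZfun r hr
    rw [heq.deriv_eq, (hZ s hs).2.2.2.2.2.1.deriv]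
  -- S2 from the crux (the lead's reduction), at `ε = 1/(8W²)`
  have hW2 : 0 < W ^ 2 := pow_pos hW 2
  obtain ⟨t₁, ht₁, hS2⟩ := ProductionEfficiencyDecay.depletion_of_productionEfficiencyDecay hE c ν T hc
    hν hT u p hmax hLH hdec Zr Pr Sr hZ (1 / (8 * W ^ 2)) (by positivity)
  filter_upwards [Ioo_mem_nhdsLT ht₁.2] with t ht
  refine eq_empty_of_forall_notMem fun s hs => ?_
  obtain ⟨hsI, hgrow⟩ := hs
  have hs0 : s ∈ Ioo 0 T := ⟨ht₁.1.trans (ht.1.trans hsI.1), hsI.2⟩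
  have hs1 : s ∈ Ico t₁ T := ⟨(ht.1.trans hsI.1).le, hsI.2⟩
  obtain ⟨hZs, hdep⟩ := hS2 s hs1
  rw [hZfun s hs0, hderiv s hs0] at hgrow
  have hZ3 : 0 < Zr s ^ 3 := pow_pos hZs 3
  have h1 : Zr s ^ 3 / (4 * W ^ 2) ≤ 1 / (8 * W ^ 2) * Zr s ^ 3 := hgrow.trans hdep
  rw [div_le_iff₀ (by positivity : (0:ℝ) < 4 * W ^ 2)] at h1
  have h2 : 1 / (8 * W ^ 2) * Zr s ^ 3 * (4 * W ^ 2) = Zr s ^ 3 / 2 := by field_simp; ring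
  linarith

/-- **`ProductionEfficiencyDecay ⇒ VanishingGrowthDensity`** (the upper slice of the sandwich): the crux
implies, along every maximal smooth Leray–Hopf rapidly-decaying-datum solution, the vanishing-growth-density
hypothesis of `floor_of_vanishingGrowthDensity` / `navierStokesRegularity_of_vanishingGrowthDensity_of_quarterLaw`
(indeed with measure `0`). Nothing about NS regularity is asserted. [folklore] -/
theorem vanishingGrowthDensity_of_productionEfficiencyDecay
    (hE : Summit.NavierStokesRegularity.NavierStokesRegularity.Theses.EfficiencyFloor.ProductionEfficiencyDecay) :
    ∀ (ν T : ℝ), 0 < ν → 0 < T →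
      ∀ (u : ℝ → EuclideanSpace ℝ (Fin 3) → EuclideanSpace ℝ (Fin 3))
        (p : ℝ → EuclideanSpace ℝ (Fin 3) → ℝ),
        IsMaximalSmoothSolution ν 0 u p T → IsLerayHopfOn T ν 0 (u 0) u → HasRapidSpatialDecay (u 0) →
        ∀ W : ℝ, 0 < W → ∀ κ : ℝ, 0 < κ → ∀ᶠ t in 𝓝[<] T,
          volume {s | s ∈ Ioo t T ∧
            (∫⁻ x, ‖curl (u s) x‖ₑ ^ 2).toReal ^ 3 / (4 * W ^ 2) ≤
              deriv (fun r => (∫⁻ x, ‖curl (u r) x‖ₑ ^ 2).toReal) s} ≤ ENNReal.ofReal (κ * (T - t)) := by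
  intro ν T hν hT u p hmax hLH hdec W hW κ _
  filter_upwards [growthSet_eq_empty_of_productionEfficiencyDecay hE hν hT hmax hLH hdec hW] with t ht
  rw [ht, measure_empty]
  exact bot_le

/-- **The sandwich, solution by solution**: `ProductionEfficiencyDecay` gives the super-Leray floor
`K/√(T−t) < Z(t)` (eventually, every `K`) THROUGH vanishing growth density — an alternative proof of the
content of `FloorOfEfficiencyDecay` (stmt-22868) factoring over the weaker statement. [folklore] -/
theorem floor_of_productionEfficiencyDecay_via_density
    (hE : Summit.NavierStokesRegularity.NavierStokesRegularity.Theses.EfficiencyFloor.ProductionEfficiencyDecay)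
    (hν : 0 < ν) (hT : 0 < T) (hmax : IsMaximalSmoothSolution ν 0 u p T)
    (hLH : IsLerayHopfOn T ν 0 (u 0) u) (hdec : HasRapidSpatialDecay (u 0)) (K : ℝ) :
    ∀ᶠ t in 𝓝[<] T, ENNReal.ofReal (K / Real.sqrt (T - t)) < ∫⁻ x, ‖curl (u t) x‖ₑ ^ 2 :=
  floor_of_vanishingGrowthDensity hν hT hmax hLH hdec
    (vanishingGrowthDensity_of_productionEfficiencyDecay hE ν T hν hT u p hmax hLH hdec) K

end TypeIRecurrence

end Summit.NavierStokesRegularity.NavierStokesRegularity.Theorems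

end
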